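import Literature.AlgebraicGeometry.Frobenioids.QuasiTemperoidGaloisFields
import Literature.AnabelianGeometry.AbsoluteAnabelian.MLFGaloisModelPairs
import Literature.AnabelianGeometry.AbsoluteAnabelian.MonoidKummerMapsProofs
import Literature.AnabelianGeometry.AbsoluteAnabelian.GaloisPadicLogIntegers
import Literature.AnabelianGeometry.AbsoluteAnabelian.MLFGaloisPairsWitness
import Mathlib.NumberTheory.Padics.Complex
import HarnessLib

/-!
# The [FrdII] Thm 2.4 (ii) pair `(G ⥲ G₂, ℚ̄_{p₁}^× ⥲ ℚ̄_{p₂}^×)` of a `p`-adic Frobenioid AS AN [AbsTopIII] Def 3.1 `TM`-pair isomorphism —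
# the adapter that makes abc-iut-L4-t2's `PairIsoDeterminedByGalois` ([AbsTopIII] Prop 3.2 (iv), PROVED) consumable at a `p`-adic Frobenioid
# (cell abc-iut, L5 hub node IUTchI:Cor5.3(ii), SUBDAG-IUTchI-Cor53 v1.1 §R row «C53ii/N3 FRDII-PAIRISO-TO-L4-PAIR»; small defs + proofs)

S. Mochizuki, *Inter-universal Teichmüller theory I*, kurims manuscript (May 2020), proof of Corollary 5.3 (ii), p. 144 l. 36–39:
«it follows from [AbsTopIII], Proposition 3.2, (iv) [cf. Remark 3.1.1; Definition 5.2 (vi), (viii)] that the natural map from isomorphisms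
`¹ℱ_v ⥲ ²ℱ_v` to isomorphisms `¹𝒟_v ⥲ ²𝒟_v` is bijective at `v ∈ 𝕍^non`» ([IUTchI] Cor 5.3 (ii) p.144) [claim: Mochizuki2012, status: disputed]
(claim key; this file is an ADAPTER between two of OUR interfaces, nothing of the series is asserted, no side is taken on [IUTchIII] Cor. 3.12);
S. Mochizuki, *The geometry of Frobenioids II*, Thm 2.4 (ii) p. 21 [cite: MochizukiFrdII2008, Thm 2.4 (ii) p.21] («`Ψ` induces a pair of compatible
isomorphisms `G₁ ⥲ G₂`; `K̄₁^× ⥲ K̄₂^×`»); S. Mochizuki, *Topics in absolute anabelian geometry III*, Def 3.1 (i)(ii) pp. 66–67, Prop 3.2 (iv) p. 72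
[cite: MochizukiAbsTopIII2015, Definition 3.1 (ii) p.67] («`(Π ↷ M)` … `T ∈ {TCG, TLG, TM}`»; «induces an injection `Isom((Π ↷ M_T), (Π* ↷ M*_T)) ↪
Isom_TG(Π, Π*)`»).

## Why an adapter, and what it does (L5-t4 CENSUS Cor5.3 v1.1 §B C53ii/L04 (a)–(c), §R N3)

abc-iut-L1's [FrdII] Thm 2.4 (ii) lineage (`PadicFrobenioidPairIso*`, p422264 and sequels) delivers, for an equivalence `Ψ` of `pᵢ`-adic Frobenioids
over the genuine §2 bases `φᵢ : Πᵢ →* G_{ℚ_{pᵢ}}`, a compatible pair `φ : Π₁ ≃ₜ* Π₂`, `ψ̄ : ℚ̄_{p₁}^× ⥲ ℚ̄_{p₂}^×`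
(`exists_pairIso_fbarUnits_integral`, with ONE-SIDED integrality `‖a‖ ≤ 1 ⇒ ‖ψ̄ a‖ ≤ 1` under print's orientation input).  abc-iut-L4-t2's
[AbsTopIII] Prop 3.2 (iv), `PairIsoDeterminedByGalois` — PROVED, `pairIsoDeterminedByGalois_holds` — is typed over `GaloisMonoidPair.{0}` and
for the type `T = TM`, whose model monoid is `𝒪_k̄^⊳` (NOT a group).  Packaging the L1 pair on the GROUP `ℚ̄_p^×` with a `.TM` binder would make that
binder vacuous; so the adapter packages the INTEGRAL part:

* §1 `tmPairOfGaloisHom φ₁ hφ₁ : GaloisMonoidPair.{0}` — `(Π ↷ 𝒪^⊳_{ℚ̄_p})`: `Pi := Π`, `M :=` abc-iut-L4-t2's `nonzeroIntegers ℚ_[p] ℚ̄_p`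
  VERBATIM, `Π` acting through a continuous `φ₁ : Π →* G_{ℚ_p}`; openness of stabilisers PROVED (Krull topology, pulled back along `φ₁`);
* §2 `tmPairIsoOfPair` — the DISPLAYED data of a Ψ-induced pair `(φ, ψ̄)` with its equivariance `hequiv` and TWO-SIDED integrality `hint`
  (`‖u‖ ≤ 1 ↔ ‖ψ̄ u‖ ≤ 1`; L1 proves `→`, the converse `←` is DISPLAYED — residual «N3b CONVERSE-INTEGRALITY», expected from L1's orientation
  §4 `exists_pairIso_absAnabChart_unitsTransport`) packaged as a `GaloisMonoidPair.Iso` of the two `TM`-pairs (`ψ̄` restricted to `𝒪^⊳` through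
  abc-iut-L3-t11's `PadicAlgCl.mem_integersClosure_iff : x ∈ 𝒪_{ℚ̄_p} ↔ ‖x‖ ≤ 1`);
* §3 the CONSUMABLE FORM of Prop 3.2 (iv) at a `p`-adic Frobenioid: `tmPairIso_isoM_eq_of_isoPi_eq` (any two pair-isomorphisms of these
  `TM`-pairs with the same Galois component agree on `𝒪^⊳`) and `psibar_apply_eq_of_galois_eq` (two Ψ-induced `ψ̄`, `ψ̄′` over the SAME `φ` agree on
  every `p₁`-adic integer) — modulo the DISPLAYED binders `IsMLFGaloisMonoidPair .TM` of the two pairs (SUBDAG v1.1's «REAL-datum instance of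
  `IsMLFGaloisMonoidPair .TM`», NOT proved here for a general open `φ₁`);
* §4 NON-VACUITY of that binder AT THE BASE FIELD `ℚ_p`: for `φ₁` SURJECTIVE onto `G_{ℚ_p}` (base `𝓑(G_{ℚ_p})⁰`, abc-iut-L1's
  `PadicFrobenioidPairIsoGaloisBase`) the pair IS abc-iut-L4-t2's model `TM`-pair of the model data `(ℚ_p, ℚ̄_p, φ₁)` up to the identity
  isomorphism, hence `IsMLFGaloisMonoidPair .TM` (`isMLFGaloisMonoidPair_tmPairOfGaloisHom_of_surjective`).  The general open-image case (fixed field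
  of `φ₁.range`; abc-iut-L6-d2's `PadicAlgCl.isNonarchimedeanLocalField_subfield` / `subfieldGalEquiv` + infinite Galois correspondence) is the named
  residual «N3c TM-INSTANCE-OVER-FIXED-FIELD».

Nothing of L1/L4 is restated (consumed BY NAME: `GaloisMonoidPair`(.Iso), `IsMLFGaloisMonoidPair`, `nonzeroIntegers`, `smul_mem_nonzeroIntegers`,
`ModelMLFGaloisData.toUnit`/`tmPair`/`monoidPair_TM`, `MLFClosure.ofPadic`, `pairIsoDeterminedByGalois_holds`, `PadicAlgCl.mem_integersClosure_iff`,
`QuasiTemperoid.Fbar`/`GalFbar`); no `Prop` fact is minted; binders are displayed; typed ≠ proved; binder ≠ fact.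
-/

noncomputable section

namespace Literature.IUT.HodgeTheaters

open Literature.AlgebraicGeometry.Frobenioids Literature.AlgebraicGeometry.Frobenioids.QuasiTemperoid
open Literature.AnabelianGeometry.AbsoluteAnabelian

namespace PadicTMPair

section Pair

variable {p : ℕ} [Fact p.Prime] {G : Type} [Group G] [TopologicalSpace G] [IsTopologicalGroup G]
  (φ₁ : G →* GalFbar ℚ_[p]) (hφ₁ : Continuous φ₁)

/-! ### §1. The `TM`-pair `(Π ↷ 𝒪^⊳_{ℚ̄_p})` of a continuous `φ₁ : Π →* G_{ℚ_p}` -/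

/-- The action of `Π` on abc-iut-L4-t2's `𝒪^⊳_{ℚ̄_p} = nonzeroIntegers ℚ_[p] ℚ̄_p` THROUGH `φ₁ : Π →* G_{ℚ_p}` («a continuous action of `Π` on
`M`», by monoid automorphisms; `G_{ℚ_p}` preserves `𝒪^⊳`: `smul_mem_nonzeroIntegers`).  Same term shape as abc-iut-L4-t2's
`ModelMLFGaloisData.submonoidAction`, but WITHOUT the surjectivity of the augmentation. [cite: MochizukiAbsTopIII2015, Definition 3.1 (ii) p.67] -/
@[reducible] def action : MulDistribMulAction G ↥(nonzeroIntegers ℚ_[p] (Fbar ℚ_[p])) where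
  smul g x := ⟨φ₁ g • (x : Fbar ℚ_[p]), smul_mem_nonzeroIntegers (φ₁ g) x.2⟩
  one_smul x := Subtype.ext (by
    change φ₁ 1 • (x : Fbar ℚ_[p]) = x
    rw [map_one, one_smul])
  mul_smul g h x := Subtype.ext (by
    change φ₁ (g * h) • (x : Fbar ℚ_[p]) = φ₁ g • (φ₁ h • (x : Fbar ℚ_[p]))
    rw [map_mul, mul_smul])
  smul_mul g x y := Subtype.ext (by
    change φ₁ g • ((x : Fbar ℚ_[p]) * y) = φ₁ g • (x : Fbar ℚ_[p]) * φ₁ g • (y : Fbar ℚ_[p])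
    exact smul_mul' _ _ _)
  smul_one g := Subtype.ext (by
    change φ₁ g • (1 : Fbar ℚ_[p]) = 1
    exact smul_one _)

omit [TopologicalSpace G] [IsTopologicalGroup G] in
/-- The action on underlying elements of `ℚ̄_p`: `g • x = φ₁(g)(x)`. [cite: MochizukiAbsTopIII2015, Definition 3.1 (ii) p.67] -/
theorem coe_smul (g : G) (x : ↥(nonzeroIntegers ℚ_[p] (Fbar ℚ_[p]))) :
    letI := action φ₁
    ((g • x : ↥(nonzeroIntegers ℚ_[p] (Fbar ℚ_[p]))) : Fbar ℚ_[p]) = φ₁ g (x : Fbar ℚ_[p]) := rfl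

include hφ₁ in
/-- **Point stabilisers are open** («continuity of the action … openness of point stabilisers», Rmk 3.1.1 p.70): the stabiliser of a non-zero integer
`x ∈ ℚ̄_p` in `Π` contains the `φ₁`-preimage of the open subgroup `Gal(ℚ̄_p/ℚ_p(x))` (Krull topology; `ℚ_p(x)/ℚ_p` is finite).
[cite: MochizukiAbsTopIII2015, Definition 3.1 (ii) p.67] -/
theorem isOpen_stabilizer (x : ↥(nonzeroIntegers ℚ_[p] (Fbar ℚ_[p]))) :
    IsOpen ((@MulAction.stabilizer G ↥(nonzeroIntegers ℚ_[p] (Fbar ℚ_[p])) _ (action φ₁).toMulAction x : Subgroup G) : Set G) := by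
  letI := action φ₁
  haveI : FiniteDimensional ℚ_[p] (IntermediateField.adjoin ℚ_[p] {(x : Fbar ℚ_[p])}) :=
    IntermediateField.adjoin.finiteDimensional (Algebra.IsAlgebraic.isAlgebraic (x : Fbar ℚ_[p])).isIntegral
  have hU : IsOpen (((IntermediateField.adjoin ℚ_[p] {(x : Fbar ℚ_[p])}).fixingSubgroup.comap φ₁ : Subgroup G) : Set G) := by
    rw [Subgroup.coe_comap]
    exact (IntermediateField.fixingSubgroup_isOpen _).preimage hφ₁
  refine Subgroup.isOpen_mono ?_ hU
  intro g hg
  rw [MulAction.mem_stabilizer_iff]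
  apply Subtype.ext
  rw [coe_smul]
  exact (IntermediateField.mem_fixingSubgroup_iff _ _).mp hg _
    (IntermediateField.subset_adjoin ℚ_[p] _ (Set.mem_singleton _))

/-- **The `TM`-pair `(Π ↷ 𝒪^⊳_{ℚ̄_p})` of a continuous `φ₁ : Π →* G_{ℚ_p}`** — the shape `(Π ↷ M)`, `T = TM`, of [AbsTopIII] Def 3.1 (ii) at the
Frobenioid-theoretic side of a `p`-adic Frobenioid over the base `φ₁` ([FrdII] Thm 2.4 (ii): the Galois group `G = Im(φ₁) ⊆ G_{ℚ_p}` of the base acting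
on `𝒪^⊳(−)` of the field extensions).  `Pi := Π`, `M := nonzeroIntegers ℚ_[p] ℚ̄_p` (abc-iut-L4-t2), action through `φ₁`.
[cite: MochizukiAbsTopIII2015, Definition 3.1 (ii) p.67] -/
def tmPairOfGaloisHom : GaloisMonoidPair.{0} where
  Pi := G
  M := ↥(nonzeroIntegers ℚ_[p] (Fbar ℚ_[p]))
  instAction := action φ₁
  isOpen_stabilizer := isOpen_stabilizer φ₁ hφ₁

/-- Its group is `Π`. [cite: MochizukiAbsTopIII2015, Definition 3.1 (ii) p.67] -/
theorem tmPairOfGaloisHom_Pi : (tmPairOfGaloisHom φ₁ hφ₁).Pi = G := rfl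

/-- Its monoid is `𝒪^⊳_{ℚ̄_p}`. [cite: MochizukiAbsTopIII2015, Definition 3.1 (ii) p.67] -/
theorem tmPairOfGaloisHom_M : (tmPairOfGaloisHom φ₁ hφ₁).M = ↥(nonzeroIntegers ℚ_[p] (Fbar ℚ_[p])) := rfl

end Pair

/-! ### §2. A Ψ-induced pair `(φ, ψ̄)` as an isomorphism of `TM`-pairs -/

section PairIso

variable {p₁ p₂ : ℕ} [Fact p₁.Prime] [Fact p₂.Prime]
  {G : Type} [Group G] [TopologicalSpace G] [IsTopologicalGroup G]
  {G₂ : Type} [Group G₂] [TopologicalSpace G₂] [IsTopologicalGroup G₂]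
  (φ₁ : G →* GalFbar ℚ_[p₁]) (hφ₁ : Continuous φ₁) (φ₂ : G₂ →* GalFbar ℚ_[p₂]) (hφ₂ : Continuous φ₂)

/-- **`ψ̄` restricted to `𝒪^⊳`**: a group isomorphism `ψ̄ : ℚ̄_{p₁}^× ⥲ ℚ̄_{p₂}^×` carrying `p₁`-adic integers EXACTLY onto `p₂`-adic integers
(`hint`, two-sided) restricts to a monoid isomorphism `𝒪^⊳_{ℚ̄_{p₁}} ⥲ 𝒪^⊳_{ℚ̄_{p₂}}` (abc-iut-L3-t11's `PadicAlgCl.mem_integersClosure_iff`: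
`𝒪_{ℚ̄_p} = {‖x‖ ≤ 1}`). [cite: MochizukiAbsTopIII2015, Definition 3.1 (i) p.66] -/
def restrictNonzeroIntegers (ψbar : (Fbar ℚ_[p₁])ˣ ≃* (Fbar ℚ_[p₂])ˣ)
    (hint : ∀ u : (Fbar ℚ_[p₁])ˣ,
      ‖(show PadicAlgCl p₁ from (u : Fbar ℚ_[p₁]))‖ ≤ 1 ↔ ‖(show PadicAlgCl p₂ from ((ψbar u : (Fbar ℚ_[p₂])ˣ) : Fbar ℚ_[p₂]))‖ ≤ 1) :
    ↥(nonzeroIntegers ℚ_[p₁] (Fbar ℚ_[p₁])) ≃* ↥(nonzeroIntegers ℚ_[p₂] (Fbar ℚ_[p₂])) where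
  toFun x := ⟨((ψbar (ModelMLFGaloisData.toUnit x) : (Fbar ℚ_[p₂])ˣ) : Fbar ℚ_[p₂]),
    (PadicAlgCl.mem_integersClosure_iff _).mpr ((hint _).mp ((PadicAlgCl.mem_integersClosure_iff _).mp x.2.1)),
    Units.ne_zero _⟩
  invFun y := ⟨((ψbar.symm (ModelMLFGaloisData.toUnit y) : (Fbar ℚ_[p₁])ˣ) : Fbar ℚ_[p₁]),
    (PadicAlgCl.mem_integersClosure_iff _).mpr ((hint _).mpr (by
      rw [MulEquiv.apply_symm_apply]
      exact (PadicAlgCl.mem_integersClosure_iff _).mp y.2.1)),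
    Units.ne_zero _⟩
  left_inv x := by
    apply Subtype.ext
    have h : ModelMLFGaloisData.toUnit
        (⟨((ψbar (ModelMLFGaloisData.toUnit x) : (Fbar ℚ_[p₂])ˣ) : Fbar ℚ_[p₂]),
          (PadicAlgCl.mem_integersClosure_iff _).mpr ((hint _).mp ((PadicAlgCl.mem_integersClosure_iff _).mp x.2.1)),
          Units.ne_zero _⟩ : ↥(nonzeroIntegers ℚ_[p₂] (Fbar ℚ_[p₂]))) = ψbar (ModelMLFGaloisData.toUnit x) :=
      Units.ext rfl
    change ((ψbar.symm (ModelMLFGaloisData.toUnit _) : (Fbar ℚ_[p₁])ˣ) : Fbar ℚ_[p₁]) = x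
    rw [h, MulEquiv.symm_apply_apply]
    rfl
  right_inv y := by
    apply Subtype.ext
    have h : ModelMLFGaloisData.toUnit
        (⟨((ψbar.symm (ModelMLFGaloisData.toUnit y) : (Fbar ℚ_[p₁])ˣ) : Fbar ℚ_[p₁]),
          (PadicAlgCl.mem_integersClosure_iff _).mpr ((hint _).mpr (by
            rw [MulEquiv.apply_symm_apply]
            exact (PadicAlgCl.mem_integersClosure_iff _).mp y.2.1)),
          Units.ne_zero _⟩ : ↥(nonzeroIntegers ℚ_[p₁] (Fbar ℚ_[p₁]))) = ψbar.symm (ModelMLFGaloisData.toUnit y) :=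
      Units.ext rfl
    change ((ψbar (ModelMLFGaloisData.toUnit _) : (Fbar ℚ_[p₂])ˣ) : Fbar ℚ_[p₂]) = y
    rw [h, MulEquiv.apply_symm_apply]
    rfl
  map_mul' x y := by
    apply Subtype.ext
    change ((ψbar (ModelMLFGaloisData.toUnit (x * y)) : (Fbar ℚ_[p₂])ˣ) : Fbar ℚ_[p₂]) =
      ((ψbar (ModelMLFGaloisData.toUnit x) : (Fbar ℚ_[p₂])ˣ) : Fbar ℚ_[p₂]) *
        ((ψbar (ModelMLFGaloisData.toUnit y) : (Fbar ℚ_[p₂])ˣ) : Fbar ℚ_[p₂])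
    rw [ModelMLFGaloisData.toUnit_mul, map_mul, Units.val_mul]

/-- `restrictNonzeroIntegers` on underlying elements: it IS `ψ̄`. [cite: MochizukiAbsTopIII2015, Definition 3.1 (i) p.66] -/
theorem coe_restrictNonzeroIntegers (ψbar : (Fbar ℚ_[p₁])ˣ ≃* (Fbar ℚ_[p₂])ˣ)
    (hint : ∀ u : (Fbar ℚ_[p₁])ˣ,
      ‖(show PadicAlgCl p₁ from (u : Fbar ℚ_[p₁]))‖ ≤ 1 ↔ ‖(show PadicAlgCl p₂ from ((ψbar u : (Fbar ℚ_[p₂])ˣ) : Fbar ℚ_[p₂]))‖ ≤ 1)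
    (x : ↥(nonzeroIntegers ℚ_[p₁] (Fbar ℚ_[p₁]))) :
    ((restrictNonzeroIntegers ψbar hint x : ↥(nonzeroIntegers ℚ_[p₂] (Fbar ℚ_[p₂]))) : Fbar ℚ_[p₂]) =
      ((ψbar (ModelMLFGaloisData.toUnit x) : (Fbar ℚ_[p₂])ˣ) : Fbar ℚ_[p₂]) := rfl

/-- **The Ψ-induced pair as an isomorphism of `TM`-pairs** `(Π₁ ↷ 𝒪^⊳_{ℚ̄_{p₁}}) ⥲ (Π₂ ↷ 𝒪^⊳_{ℚ̄_{p₂}})` ([AbsTopIII] Def 3.1 (ii): «an isomorphism of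
topological groups `Π_k ⥲ Π` and an isomorphism of objects `M_k̄ ⥲ M` of `T` that are compatible with the respective actions»): `isoPi := φ`,
`isoM := ψ̄|_{𝒪^⊳}`, compatibility from the DISPLAYED equivariance `hequiv` of the [FrdII] Thm 2.4 (ii) pair (the shape abc-iut-L1's
`exists_pairIso_fbarUnits_integral` conclusions `hψ`/`hequiv` compose to) and the DISPLAYED two-sided integrality `hint`.
[cite: MochizukiAbsTopIII2015, Definition 3.1 (ii) p.67] -/
def tmPairIsoOfPair (φ : G ≃ₜ* G₂) (ψbar : (Fbar ℚ_[p₁])ˣ ≃* (Fbar ℚ_[p₂])ˣ)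
    (hint : ∀ u : (Fbar ℚ_[p₁])ˣ,
      ‖(show PadicAlgCl p₁ from (u : Fbar ℚ_[p₁]))‖ ≤ 1 ↔ ‖(show PadicAlgCl p₂ from ((ψbar u : (Fbar ℚ_[p₂])ˣ) : Fbar ℚ_[p₂]))‖ ≤ 1)
    (hequiv : ∀ (g : G) (u : (Fbar ℚ_[p₁])ˣ),
      ψbar (Units.map ((φ₁ g : GalFbar ℚ_[p₁]) : Fbar ℚ_[p₁] →* Fbar ℚ_[p₁]) u) =
        Units.map ((φ₂ (φ g) : GalFbar ℚ_[p₂]) : Fbar ℚ_[p₂] →* Fbar ℚ_[p₂]) (ψbar u)) :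
    GaloisMonoidPair.Iso (tmPairOfGaloisHom φ₁ hφ₁) (tmPairOfGaloisHom φ₂ hφ₂) where
  isoPi := φ
  isoM := restrictNonzeroIntegers ψbar hint
  smul_comm g x := by
    apply Subtype.ext
    have h : ModelMLFGaloisData.toUnit (g • x) =
        Units.map ((φ₁ g : GalFbar ℚ_[p₁]) : Fbar ℚ_[p₁] →* Fbar ℚ_[p₁]) (ModelMLFGaloisData.toUnit x) :=
      Units.ext rfl
    have h2 := congrArg (fun u : (Fbar ℚ_[p₁])ˣ => ((ψbar u : (Fbar ℚ_[p₂])ˣ) : Fbar ℚ_[p₂])) h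
    refine h2.trans ?_
    rw [hequiv]
    rfl

/-- The Galois component of `tmPairIsoOfPair` is `φ`. [cite: MochizukiAbsTopIII2015, Definition 3.1 (ii) p.67] -/
theorem tmPairIsoOfPair_isoPi (φ : G ≃ₜ* G₂) (ψbar : (Fbar ℚ_[p₁])ˣ ≃* (Fbar ℚ_[p₂])ˣ)
    (hint : ∀ u : (Fbar ℚ_[p₁])ˣ,
      ‖(show PadicAlgCl p₁ from (u : Fbar ℚ_[p₁]))‖ ≤ 1 ↔ ‖(show PadicAlgCl p₂ from ((ψbar u : (Fbar ℚ_[p₂])ˣ) : Fbar ℚ_[p₂]))‖ ≤ 1)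
    (hequiv : ∀ (g : G) (u : (Fbar ℚ_[p₁])ˣ),
      ψbar (Units.map ((φ₁ g : GalFbar ℚ_[p₁]) : Fbar ℚ_[p₁] →* Fbar ℚ_[p₁]) u) =
        Units.map ((φ₂ (φ g) : GalFbar ℚ_[p₂]) : Fbar ℚ_[p₂] →* Fbar ℚ_[p₂]) (ψbar u)) :
    (tmPairIsoOfPair φ₁ hφ₁ φ₂ hφ₂ φ ψbar hint hequiv).isoPi = φ := rfl

/-- The monoid component of `tmPairIsoOfPair`, on underlying elements, is `ψ̄`. [cite: MochizukiAbsTopIII2015, Definition 3.1 (ii) p.67] -/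
theorem coe_tmPairIsoOfPair_isoM (φ : G ≃ₜ* G₂) (ψbar : (Fbar ℚ_[p₁])ˣ ≃* (Fbar ℚ_[p₂])ˣ)
    (hint : ∀ u : (Fbar ℚ_[p₁])ˣ,
      ‖(show PadicAlgCl p₁ from (u : Fbar ℚ_[p₁]))‖ ≤ 1 ↔ ‖(show PadicAlgCl p₂ from ((ψbar u : (Fbar ℚ_[p₂])ˣ) : Fbar ℚ_[p₂]))‖ ≤ 1)
    (hequiv : ∀ (g : G) (u : (Fbar ℚ_[p₁])ˣ),
      ψbar (Units.map ((φ₁ g : GalFbar ℚ_[p₁]) : Fbar ℚ_[p₁] →* Fbar ℚ_[p₁]) u) =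
        Units.map ((φ₂ (φ g) : GalFbar ℚ_[p₂]) : Fbar ℚ_[p₂] →* Fbar ℚ_[p₂]) (ψbar u))
    (x : ↥(nonzeroIntegers ℚ_[p₁] (Fbar ℚ_[p₁]))) :
    ((show ↥(nonzeroIntegers ℚ_[p₂] (Fbar ℚ_[p₂])) from (tmPairIsoOfPair φ₁ hφ₁ φ₂ hφ₂ φ ψbar hint hequiv).isoM x) : Fbar ℚ_[p₂]) =
      ((ψbar (ModelMLFGaloisData.toUnit x) : (Fbar ℚ_[p₂])ˣ) : Fbar ℚ_[p₂]) := rfl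

omit [IsTopologicalGroup G] [IsTopologicalGroup G₂] in
/-- **Glue to abc-iut-L1's conclusion shape.**  abc-iut-L1's `exists_pairIso_fbarUnits_integral` ([FrdII] Thm 2.4 (ii) over the genuine §2 bases)
states the compatibility through an isomorphism of IMAGES `ψ : φ₁(Π₁) ⥲ φ₂(Π₂)` with `ψ(φ₁ g) = φ₂(φ g)` (`hψ`) and `ψ̄(σ·u) = ψ(σ)·ψ̄(u)` for
`σ ∈ φ₁(Π₁)` (`hequiv'`); these two compose to the `Π₁`-equivariance `hequiv` displayed by `tmPairIsoOfPair`.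
[cite: MochizukiFrdII2008, Thm 2.4 (ii) p.21] -/
theorem hequiv_of_rangeEquiv (φ : G ≃ₜ* G₂) (ψ : φ₁.range ≃ₜ* φ₂.range) (ψbar : (Fbar ℚ_[p₁])ˣ ≃* (Fbar ℚ_[p₂])ˣ)
    (hψ : ∀ g : G, ((ψ ⟨φ₁ g, ⟨g, rfl⟩⟩ : φ₂.range) : GalFbar ℚ_[p₂]) = φ₂ (φ g))
    (hequiv' : ∀ (σ : φ₁.range) (u : (Fbar ℚ_[p₁])ˣ),
      ψbar (Units.map ((σ : GalFbar ℚ_[p₁]) : Fbar ℚ_[p₁] →* Fbar ℚ_[p₁]) u) =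
        Units.map (((ψ σ : φ₂.range) : GalFbar ℚ_[p₂]) : Fbar ℚ_[p₂] →* Fbar ℚ_[p₂]) (ψbar u))
    (g : G) (u : (Fbar ℚ_[p₁])ˣ) :
    ψbar (Units.map ((φ₁ g : GalFbar ℚ_[p₁]) : Fbar ℚ_[p₁] →* Fbar ℚ_[p₁]) u) =
      Units.map ((φ₂ (φ g) : GalFbar ℚ_[p₂]) : Fbar ℚ_[p₂] →* Fbar ℚ_[p₂]) (ψbar u) := by
  have h := hequiv' ⟨φ₁ g, ⟨g, rfl⟩⟩ u
  rw [hψ g] at h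
  exact h

/-! ### §3. [AbsTopIII] Prop 3.2 (iv) CONSUMABLE at a `p`-adic Frobenioid -/

/-- **[AbsTopIII] Prop 3.2 (iv) at the `TM`-pairs of `p`-adic Frobenioid bases** («induces an injection `Isom((Π ↷ M_T), (Π* ↷ M*_T)) ↪
Isom_TG(Π, Π*)`»): two isomorphisms of the `TM`-pairs `(Π₁ ↷ 𝒪^⊳_{ℚ̄_{p₁}}) ⥲ (Π₂ ↷ 𝒪^⊳_{ℚ̄_{p₂}})` with the SAME Galois component have the same monoid
component — abc-iut-L4-t2's `pairIsoDeterminedByGalois_holds` BY NAME, modulo the DISPLAYED binders «the two pairs are MLF-Galois `TM`-pairs»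
(§4 discharges them at the base field `ℚ_p`). [cite: MochizukiAbsTopIII2015, Proposition 3.2 (iv) p.72] -/
theorem tmPairIso_isoM_eq_of_isoPi_eq (hTM₁ : IsMLFGaloisMonoidPair .TM (tmPairOfGaloisHom φ₁ hφ₁))
    (hTM₂ : IsMLFGaloisMonoidPair .TM (tmPairOfGaloisHom φ₂ hφ₂))
    (e₁ e₂ : GaloisMonoidPair.Iso (tmPairOfGaloisHom φ₁ hφ₁) (tmPairOfGaloisHom φ₂ hφ₂)) (h : e₁.isoPi = e₂.isoPi) :
    e₁.isoM = e₂.isoM :=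
  pairIsoDeterminedByGalois_holds _ _ hTM₁ hTM₂ e₁ e₂ h

/-- **Two Ψ-induced pairs over the SAME Galois component agree on every `p₁`-adic integer** (the form [IUTchI] Cor 5.3 (ii)'s clause (b) consumes:
the Frobenioid-side `ψ̄` of [FrdII] Thm 2.4 (ii) is DETERMINED on `𝒪^⊳_{ℚ̄_{p₁}}` by `φ`, [AbsTopIII] Prop 3.2 (iv)) — modulo the DISPLAYED `.TM` binders.
([IUTchI] Cor 5.3 (ii) p.144) [claim: Mochizuki2012, status: disputed] -/
theorem psibar_apply_eq_of_galois_eq (hTM₁ : IsMLFGaloisMonoidPair .TM (tmPairOfGaloisHom φ₁ hφ₁))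
    (hTM₂ : IsMLFGaloisMonoidPair .TM (tmPairOfGaloisHom φ₂ hφ₂)) (φ : G ≃ₜ* G₂)
    (ψbar : (Fbar ℚ_[p₁])ˣ ≃* (Fbar ℚ_[p₂])ˣ)
    (hint : ∀ u : (Fbar ℚ_[p₁])ˣ,
      ‖(show PadicAlgCl p₁ from (u : Fbar ℚ_[p₁]))‖ ≤ 1 ↔ ‖(show PadicAlgCl p₂ from ((ψbar u : (Fbar ℚ_[p₂])ˣ) : Fbar ℚ_[p₂]))‖ ≤ 1)
    (hequiv : ∀ (g : G) (u : (Fbar ℚ_[p₁])ˣ),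
      ψbar (Units.map ((φ₁ g : GalFbar ℚ_[p₁]) : Fbar ℚ_[p₁] →* Fbar ℚ_[p₁]) u) =
        Units.map ((φ₂ (φ g) : GalFbar ℚ_[p₂]) : Fbar ℚ_[p₂] →* Fbar ℚ_[p₂]) (ψbar u))
    (ψbar' : (Fbar ℚ_[p₁])ˣ ≃* (Fbar ℚ_[p₂])ˣ)
    (hint' : ∀ u : (Fbar ℚ_[p₁])ˣ,
      ‖(show PadicAlgCl p₁ from (u : Fbar ℚ_[p₁]))‖ ≤ 1 ↔ ‖(show PadicAlgCl p₂ from ((ψbar' u : (Fbar ℚ_[p₂])ˣ) : Fbar ℚ_[p₂]))‖ ≤ 1)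
    (hequiv' : ∀ (g : G) (u : (Fbar ℚ_[p₁])ˣ),
      ψbar' (Units.map ((φ₁ g : GalFbar ℚ_[p₁]) : Fbar ℚ_[p₁] →* Fbar ℚ_[p₁]) u) =
        Units.map ((φ₂ (φ g) : GalFbar ℚ_[p₂]) : Fbar ℚ_[p₂] →* Fbar ℚ_[p₂]) (ψbar' u))
    (x : ↥(nonzeroIntegers ℚ_[p₁] (Fbar ℚ_[p₁]))) :
    ψbar (ModelMLFGaloisData.toUnit x) = ψbar' (ModelMLFGaloisData.toUnit x) := by
  have h := tmPairIso_isoM_eq_of_isoPi_eq φ₁ hφ₁ φ₂ hφ₂ hTM₁ hTM₂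
    (tmPairIsoOfPair φ₁ hφ₁ φ₂ hφ₂ φ ψbar hint hequiv) (tmPairIsoOfPair φ₁ hφ₁ φ₂ hφ₂ φ ψbar' hint' hequiv') rfl
  have hx := congrArg (fun e : ↥(nonzeroIntegers ℚ_[p₁] (Fbar ℚ_[p₁])) ≃* ↥(nonzeroIntegers ℚ_[p₂] (Fbar ℚ_[p₂])) =>
    ((e x : ↥(nonzeroIntegers ℚ_[p₂] (Fbar ℚ_[p₂]))) : Fbar ℚ_[p₂])) h
  exact Units.ext hx

end PairIso

/-! ### §4. Non-vacuity of the `.TM` binder at the base field `ℚ_p` -/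

section Surjective

variable {p : ℕ} [Fact p.Prime] {G : Type} [Group G] [TopologicalSpace G] [IsTopologicalGroup G]
  (φ₁ : G →* GalFbar ℚ_[p]) (hφ₁ : Continuous φ₁) (hsurj : Function.Surjective φ₁)

/-- For `φ₁` SURJECTIVE onto `G_{ℚ_p}` the base datum IS abc-iut-L4-t2's model data «`Π_k` a topological group equipped with a continuous surjection
`ε_k : Π_k ↠ G_k`» over abc-iut-L4-t2's concrete `MLFClosure.ofPadic p` (`k = ℚ_p`, `k̄ = ℚ̄_p`). [cite: MochizukiAbsTopIII2015, Definition 3.1 (i) p.66] -/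
def modelDataOfSurjective : ModelMLFGaloisData (MLFClosure.ofPadic p).k (MLFClosure.ofPadic p).K where
  Pi := G
  aug := φ₁
  continuous_aug := hφ₁
  aug_surjective := hsurj

/-- The identity isomorphism between abc-iut-L4-t2's model `TM`-pair of `modelDataOfSurjective` and `tmPairOfGaloisHom` (same carrier `𝒪^⊳_{ℚ̄_p}`,
same action through `φ₁`). [cite: MochizukiAbsTopIII2015, Definition 3.1 (ii) p.67] -/
def isoModelOfSurjective : GaloisMonoidPair.Iso (modelDataOfSurjective φ₁ hφ₁ hsurj).tmPair (tmPairOfGaloisHom φ₁ hφ₁) where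
  isoPi := ContinuousMulEquiv.refl G
  isoM := MulEquiv.refl _
  smul_comm _ _ := rfl

include hsurj in
/-- **NON-VACUITY of the `.TM` binder at the base field `ℚ_p`**: for `φ₁ : Π ↠ G_{ℚ_p}` continuous and SURJECTIVE, `(Π ↷ 𝒪^⊳_{ℚ̄_p})` IS an MLF-Galois
`TM`-pair (abc-iut-L4-t2's `isMLFGaloisMonoidPair_tmPair` pattern at `MLFClosure.ofPadic p`, through the identity isomorphism).
[cite: MochizukiAbsTopIII2015, Definition 3.1 (ii) p.67] -/
theorem isMLFGaloisMonoidPair_tmPairOfGaloisHom_of_surjective : IsMLFGaloisMonoidPair .TM (tmPairOfGaloisHom φ₁ hφ₁) :=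
  ⟨⟨MLFClosure.ofPadic p, modelDataOfSurjective φ₁ hφ₁ hsurj, (modelDataOfSurjective φ₁ hφ₁ hsurj).tmPair,
    (modelDataOfSurjective φ₁ hφ₁ hsurj).monoidPair_TM, ⟨isoModelOfSurjective φ₁ hφ₁ hsurj⟩⟩⟩

include hsurj in
/-- **Prop 3.2 (iv) UNCONDITIONALLY over the Galois base `𝓑(G_{ℚ_p})⁰` on both sides**: two isomorphisms of the `TM`-pairs of two surjective base
data with the same Galois component agree on `𝒪^⊳` — no binder left. [cite: MochizukiAbsTopIII2015, Proposition 3.2 (iv) p.72] -/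
theorem tmPairIso_isoM_eq_of_isoPi_eq_of_surjective {p₂ : ℕ} [Fact p₂.Prime] {G₂ : Type} [Group G₂] [TopologicalSpace G₂]
    [IsTopologicalGroup G₂] (φ₂ : G₂ →* GalFbar ℚ_[p₂]) (hφ₂ : Continuous φ₂) (hsurj₂ : Function.Surjective φ₂)
    (e₁ e₂ : GaloisMonoidPair.Iso (tmPairOfGaloisHom φ₁ hφ₁) (tmPairOfGaloisHom φ₂ hφ₂)) (h : e₁.isoPi = e₂.isoPi) :
    e₁.isoM = e₂.isoM :=
  tmPairIso_isoM_eq_of_isoPi_eq φ₁ hφ₁ φ₂ hφ₂ (isMLFGaloisMonoidPair_tmPairOfGaloisHom_of_surjective φ₁ hφ₁ hsurj)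
    (isMLFGaloisMonoidPair_tmPairOfGaloisHom_of_surjective φ₂ hφ₂ hsurj₂) e₁ e₂ h

end Surjective

end PadicTMPair

end Literature.IUT.HodgeTheaters
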